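import Summits.HodgeConjecture.HodgeConjecture.Theorems.Ring2AbelianAllAndreFibreGysinRange
import Summits.HodgeConjecture.HodgeConjecture.Theorems.Ring2AbelianAllAndreWeightGysinInvariant
import HarnessLib

/-!
# Ring 2 · sub-cell AbelianAll (ALL ABELIAN VARIETIES), André axis, part XXVI-b — THE `ν`-FREE CLAUSE (surjInv) OF PART XXV-f IS
# DISCHARGED: the Leray weights of the André axis depend on the abelian-scheme structure (θ∀) ALONE

HONEST FRAMING (page 1, verbatim): **research route, not a corollary; conditional on HC_CM plus one named
minimal statement.** Cell line: research route conditional on HC_CM; not a corollary; Q11.4-sentence-2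
already refuted in dim ≥ 3. Nothing in this file proves a case of the Hodge conjecture for an abelian variety; `HC_CM`
(`RankFourFaces.CMAbelianHodge`) is a HYPOTHESIS of the `HC_AV` rows, load-bearing as typed; item `Theses.RankFourFaces.CMToAbelian`
(stmt-16267) OPEN and not closed here. Seat `pub-hodge-ring2-ab-andre-2`, gen 18; brief (iii) "attack `B_min`: what is known".

## What this file proves (theorems only; no definition, no named fact, no sorry)

* §3 compact abelian pencils: **`exists_complexGysin_eq_of_isCompactAbelianPencil`** — the clause (surjInv) displayed in part XXV-f's
  `CMThetaInv[]` HOLDS at every point of every compact pencil of abelian varieties (part XXVI-a's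
  `exists_complexGysin_fiberι_eq_complexGysin_map` with `m = 1`, `N = d + 1`); **`gysinWeight_of_chart`: (gysFib)
  `ν^* ∘ j_{s*} = Nᵃ · j_{s*}` on `Hᵃ(X_s)` from the chart of `ν` by `[N]` at `s` ALONE** (part XXV-f's `gysinWeight_of_range_le`).
* §4 node level (display-only brackets, F-ab-103): **`PencilTheta[]`** := (θ∀) "every compact pencil of abelian varieties with a CM
  fibre carries a locally quasi-finite `S`-endomorphism `ν` and `N ≥ 2` with `ν` charted by `N · 𝟙_A` on EVERY fibre" — the
  abelian-scheme structure of the pencil (print: Mumford GIT Thm. 6.14 + rigidity; `θ_N`); **`cmThetaInv_of_pencilTheta`**,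
  **`cmWeights_of_pencilTheta : PencilTheta[] → CMWeights[]`**, rows `HC_AV_of_HC_CM_of_cmTopWeightHodge_of_theta (h₂₁) (hΘ) (hCM) (h)`
  and `HC_AV_iff_HC_CM_and_cmTopWeightHodge_of_verdier_of_theta`.

## Honest status

No node is born; nothing is minimal; nothing here is fact-free progress on `HC_AV`. AFTER THIS PART the displayed weight hypothesis
of every André-axis row (`CMWeights[]` of part XXIV: (wt), (wt₃), (top) — the Leray spectral sequence of `θ_N`) is a kernel
consequence of (θ∀) ALONE: the existence of the endomorphism `θ_N` of the compact pencil over `S` (abelian-scheme structure of a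
smooth projective family with a section and abelian fibres — Mumford GIT 6.14; NOT in the tree: the carriers
`IsCompactAbelianPencil` record a section and fibrewise abelian-variety charts, no group law over `S`). The chain, all kernel steps:
`PencilTheta[] ⟹ CMThetaInv[] ⟹ CMThetaGysinFib[] ⟹ CMThetaGysin[] ⟹ CMThetaRoots[] ⟹ CMWeights[]` (parts XXVI-b, XXV-f, XXV-e,
XXV-d, XXV-a).

References: DeligneHodgeII1971 (Thm. 4.1.1, Cor. 4.2.8); VoisinHodgeII2003 (§4.3.3 Thm. 4.24); FultonYoungTableaux1997 (App. B
(5)–(6)); MumfordAV1970 (§19); Milne2020HodgeClassesAV (proof of Prop. 1); MumfordGIT (Thm. 6.14); Andre1996Motifs (Lemme 6.3.1,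
Remarque 2); Verdier1976 (Cor. 5.1).
-/

noncomputable section

set_option linter.dupNamespace false

namespace Summit.HodgeConjecture.HodgeConjecture.Ring2.AbelianAll

open CategoryTheory CategoryTheory.Limits AlgebraicGeometry
open Literature.AlgebraicGeometry Literature.AlgebraicGeometry.Motives
open Literature.AlgebraicGeometry.HodgeTheory
open Literature.AlgebraicGeometry.Deligne1982 (cmLocus)
open Literature.AlgebraicGeometry.Andre1996 (andre1996_cmAnchoredPencil)
open Literature.AlgebraicTopology.SingularHomology (singularCohomology)
open Summit.HodgeConjecture.HodgeConjecture
open Summit.HodgeConjecture.HodgeConjecture.Theses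

/-! ## §3 Compact abelian pencils: (surjInv) at every point; (gysFib) from the chart at `s` alone (§1–§2 = part XXVI-a) -/

section Pencil

variable {𝒳 S : SchemeOver ℂ} {d : ℕ} {f : 𝒳 ⟶ S}

/-- **(surjInv) holds at every point of every compact pencil of abelian varieties** (part XXVI-a's `exists_complexGysin_fiberι_eq_complexGysin_map` with `m = 1`, `N = d + 1`).
[cite: DeligneHodgeII1971, Thm. 4.1.1 and Cor. 4.2.8] [cite: VoisinHodgeII2003, §4.3.3 Thm. 4.24] -/
theorem exists_complexGysin_eq_of_isCompactAbelianPencil (hf : IsCompactAbelianPencil f d) (s : ComplexPoints S)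
    (a b : ℕ) (hab : a + 2 * (d + 1) = b + 2 * d) (x : complexBetti (fiberOver f s) a) :
    ∃ y : complexBetti 𝒳 a,
      complexGysin complexOrientationFamily (hf.isSmoothProjective_fiberOver s) hf.isSmoothProjective_total (fiberι f s) hab x =
        complexGysin complexOrientationFamily (hf.isSmoothProjective_fiberOver s) hf.isSmoothProjective_total (fiberι f s) hab
          (complexBetti.map (fiberι f s) a y) :=
  exists_complexGysin_fiberι_eq_complexGysin_map hf.isSmoothProjective_base hf.isSmoothProjectiveFamily
    hf.isSmoothProjective_total hab s x

/-- **(gysFib) FROM THE CHART AT `s` ALONE**: for a compact pencil of abelian `d`-folds and an `S`-endomorphism `ν` charted by `N · 𝟙_A`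
on the fibre `X_s`, `ν^*(j_{s*} x) = Nᵃ · j_{s*} x` for every `x ∈ Hᵃ(X_s(ℂ); ℂ)` (part XXV-f's `gysinWeight_of_range_le` with its
`ν`-free clause discharged by `exists_complexGysin_eq_of_isCompactAbelianPencil`). Print: base change `θ_N^* j_{s*} = j_{s*} [N]^*` and
`[N]^* = Nᵃ` on `Hᵃ`. [cite: FultonYoungTableaux1997, Appendix B §B.1 (5)–(6)] [cite: MumfordAV1970, §19]
[cite: DeligneHodgeII1971, Cor. 4.2.8] -/
theorem gysinWeight_of_chart (hf : IsCompactAbelianPencil f d) (s : ComplexPoints S) (ν : 𝒳 ⟶ 𝒳) (hν : ν ≫ f = f) (N : ℕ)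
    (hθ : ∃ (νs : fiberOver f s ⟶ fiberOver f s) (A : AbelianVariety ℂ) (e : A.X ≅ fiberOver f s),
      νs ≫ fiberι f s = fiberι f s ≫ ν ∧ e.hom ≫ νs = (N • 𝟙 A).hom.hom.hom ≫ e.hom)
    (a b : ℕ) (hab : a + 2 * (d + 1) = b + 2 * d) (x : complexBetti (fiberOver f s) a) :
    complexBetti.map ν b (complexGysin complexOrientationFamily (hf.isSmoothProjective_fiberOver s) hf.isSmoothProjective_total
      (fiberι f s) hab x) =
      ((N : ℂ) ^ a) • complexGysin complexOrientationFamily (hf.isSmoothProjective_fiberOver s) hf.isSmoothProjective_total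
        (fiberι f s) hab x :=
  gysinWeight_of_range_le hf s ν hν N hθ (fun a b hab x ↦ exists_complexGysin_eq_of_isCompactAbelianPencil hf s a b hab x)
    a b hab x

end Pencil

/-! ## §4 Node level (display-only brackets): `PencilTheta[] ⟹ CMThetaInv[] ⟹ CMWeights[]` and the rows -/

section Nodes

/-- DISPLAY-ONLY bracket (no `def`; REFEREE-AB F-ab-103): `CMWeights[]` of part XXIV-c, restated verbatim. -/
local notation3 (prettyPrint := false) "CMWeights[]" =>
  ∀ ⦃d : ℕ⦄ ⦃𝒳 S : SchemeOver ℂ⦄ (f : 𝒳 ⟶ S), IsCompactAbelianPencil f d → ∀ t ∈ cmLocus f d,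
    ∃ (ν : 𝒳 ⟶ 𝒳) (_ : LocallyQuasiFinite ν.left) (N : ℕ), 2 ≤ N ∧
      (∀ (k : ℕ) (w : complexBetti 𝒳 k), complexBetti.map (fiberι f t) k (complexBetti.map ν k w) =
        ((N : ℂ) ^ k) • complexBetti.map (fiberι f t) k w) ∧
      (∀ (k k₁ k₂ : ℕ), k₁ + 1 = k → k₂ + 1 = k₁ → ∀ w : complexBetti 𝒳 k, ∃ w₀ w₁ w₂ : complexBetti 𝒳 k,
        w = w₀ + w₁ + w₂ ∧ complexBetti.map ν k w₀ = ((N : ℂ) ^ k) • w₀ ∧ complexBetti.map ν k w₁ = ((N : ℂ) ^ k₁) • w₁ ∧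
        complexBetti.map ν k w₂ = ((N : ℂ) ^ k₂) • w₂) ∧
      (∀ (k : ℕ) (G : complexBetti 𝒳 k), complexBetti.map ν k G = ((N : ℂ) ^ k) • G →
        complexBetti.map (fiberι f t) k G = 0 → G = 0)

/-- DISPLAY-ONLY bracket (no `def`; REFEREE-AB F-ab-103): `CMThetaInv[]` of part XXV-f, restated verbatim. -/
local notation3 (prettyPrint := false) "CMThetaInv[]" =>
  ∀ ⦃d : ℕ⦄ ⦃𝒳 S : SchemeOver ℂ⦄ (f : 𝒳 ⟶ S) (hf : IsCompactAbelianPencil f d), ∀ t ∈ cmLocus f d,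
    ∃ (ν : 𝒳 ⟶ 𝒳) (_ : LocallyQuasiFinite ν.left) (N : ℕ), 2 ≤ N ∧ ν ≫ f = f ∧
      (∀ s : ComplexPoints S, ∃ (νs : fiberOver f s ⟶ fiberOver f s) (A : AbelianVariety ℂ) (e : A.X ≅ fiberOver f s),
        νs ≫ fiberι f s = fiberι f s ≫ ν ∧ e.hom ≫ νs = (N • 𝟙 A).hom.hom.hom ≫ e.hom) ∧
      (∀ (s : ComplexPoints S) (a b : ℕ) (hab : a + 2 * (d + 1) = b + 2 * d) (x : complexBetti (fiberOver f s) a),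
        ∃ y : complexBetti 𝒳 a,
          complexGysin complexOrientationFamily (hf.isSmoothProjective_fiberOver s) hf.isSmoothProjective_total (fiberι f s) hab x =
            complexGysin complexOrientationFamily (hf.isSmoothProjective_fiberOver s) hf.isSmoothProjective_total (fiberι f s) hab
              (complexBetti.map (fiberι f s) a y))

/-- DISPLAY-ONLY bracket (no `def`; REFEREE-AB F-ab-103): `CMTopWeightHodge[]` of part XXIV-d, restated verbatim. OPEN; a HYPOTHESIS. -/
local notation3 (prettyPrint := false) "CMTopWeightHodge[]" =>
  ∀ ⦃d : ℕ⦄ ⦃𝒳 S : SchemeOver ℂ⦄ (f : 𝒳 ⟶ S), IsCompactAbelianPencil f d → ∀ t ∈ cmLocus f d,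
    ∀ (ν : 𝒳 ⟶ 𝒳) (_ : LocallyQuasiFinite ν.left) (N : ℕ), 2 ≤ N →
      (∀ (k : ℕ) (w : complexBetti 𝒳 k), complexBetti.map (fiberι f t) k (complexBetti.map ν k w) =
        ((N : ℂ) ^ k) • complexBetti.map (fiberι f t) k w) →
      (∀ (k k₁ k₂ : ℕ), k₁ + 1 = k → k₂ + 1 = k₁ → ∀ w : complexBetti 𝒳 k, ∃ w₀ w₁ w₂ : complexBetti 𝒳 k,
        w = w₀ + w₁ + w₂ ∧ complexBetti.map ν k w₀ = ((N : ℂ) ^ k) • w₀ ∧ complexBetti.map ν k w₁ = ((N : ℂ) ^ k₁) • w₁ ∧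
        complexBetti.map ν k w₂ = ((N : ℂ) ^ k₂) • w₂) →
      (∀ (k : ℕ) (G : complexBetti 𝒳 k), complexBetti.map ν k G = ((N : ℂ) ^ k) • G →
        complexBetti.map (fiberι f t) k G = 0 → G = 0) →
      ∀ (p : ℕ) (y₀ : complexBetti 𝒳 (2 * (p + 1))),
        complexBetti.map ν (2 * (p + 1)) y₀ = ((N : ℂ) ^ (2 * (p + 1))) • y₀ → IsRationalClass y₀ →
        IsOfHodgeType (d + 1) 𝒳 (2 * (p + 1)) (p + 1) (p + 1) y₀ → y₀ ∈ algebraicClasses 𝒳 (p + 1)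

/-- DISPLAY-ONLY bracket (no `def`, not a census node — REFEREE-AB F-ab-103): **`PencilTheta[]`** — (θ∀): every compact pencil of
abelian `d`-folds `f : 𝒳 ⟶ S` with a CM fibre carries a locally quasi-finite `S`-ENDOMORPHISM `ν` (`ν ≫ f = f`) and an integer `N ≥ 2`
such that on EVERY fibre `X_s` the restriction of `ν` is `N · 𝟙_A` in an abelian-variety chart `A.X ≅ X_s` (print: the
multiplication `θ_N` of the abelian scheme `𝒳 / S` — Mumford GIT Thm. 6.14 with rigidity; a PRINT THEOREM, displayed, not in the
tree: the carriers record a section and fibrewise charts, no group law over `S`). The CM point plays no role in the statement; it is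
kept only to match the quantifier prefix of `CMWeights[]`. -/
local notation3 (prettyPrint := false) "PencilTheta[]" =>
  ∀ ⦃d : ℕ⦄ ⦃𝒳 S : SchemeOver ℂ⦄ (f : 𝒳 ⟶ S), IsCompactAbelianPencil f d → (cmLocus f d).Nonempty →
    ∃ (ν : 𝒳 ⟶ 𝒳) (_ : LocallyQuasiFinite ν.left) (N : ℕ), 2 ≤ N ∧ ν ≫ f = f ∧
      ∀ s : ComplexPoints S, ∃ (νs : fiberOver f s ⟶ fiberOver f s) (A : AbelianVariety ℂ) (e : A.X ≅ fiberOver f s),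
        νs ≫ fiberι f s = fiberι f s ≫ ν ∧ e.hom ≫ νs = (N • 𝟙 A).hom.hom.hom ≫ e.hom

/-- **`PencilTheta[] ⟹ CMThetaInv[]`**: the `ν`-free clause (surjInv) of part XXV-f is §3's theorem (part XXVI-a).
[cite: DeligneHodgeII1971, Thm. 4.1.1 and Cor. 4.2.8] [cite: MumfordGIT, Thm. 6.14] -/
theorem cmThetaInv_of_pencilTheta (hΘ : PencilTheta[]) : CMThetaInv[] := by
  intro d 𝒳 S f hf t ht
  obtain ⟨ν, hν, N, hN, hνf, hθ⟩ := hΘ f hf ⟨t, ht⟩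
  exact ⟨ν, hν, N, hN, hνf, hθ, fun s a b hab x ↦ exists_complexGysin_eq_of_isCompactAbelianPencil hf s a b hab x⟩

/-- **`PencilTheta[] ⟹ CMWeights[]`: the whole Leray weight package of part XXIV ((wt), (wt₃), (top)) is a kernel consequence of the
abelian-scheme structure (θ∀) ALONE** (parts XXV-a, d, e, f, XXVI-a and §3). [cite: Milne2020HodgeClassesAV, proof of Prop. 1 (p. 7)]
[cite: MumfordGIT, Thm. 6.14] [cite: DeligneHodgeII1971, Thm. 4.1.1 and Cor. 4.2.8] -/
theorem cmWeights_of_pencilTheta (hΘ : PencilTheta[]) : CMWeights[] :=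
  cmWeights_of_cmThetaInv (cmThetaInv_of_pencilTheta hΘ)

/-- **`HC_CM ∧ [CM top-weight Hodge classes algebraic] ⟹ HC_AV`, granted [h₂₁] and (θ∀) `PencilTheta[]`** (binders in this order;
`HC_CM` = `RankFourFaces.CMAbelianHodge` a HYPOTHESIS, load-bearing). research route, not a corollary; conditional on HC_CM plus one
named minimal statement. [cite: Andre1996Motifs, Lemme 6.3.1 (p. 31) and Remarque 2 (p. 33)]
[cite: Milne2020HodgeClassesAV, proof of Prop. 1 (pp. 7–8)] [cite: MumfordGIT, Thm. 6.14] -/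
theorem HC_AV_of_HC_CM_of_cmTopWeightHodge_of_theta (h₂₁ : andre1996_cmAnchoredPencil) (hΘ : PencilTheta[])
    (hCM : RankFourFaces.CMAbelianHodge) (h : CMTopWeightHodge[]) : PadicSemiregularLift.HodgeAbelianVarieties :=
  HC_AV_of_HC_CM_of_cmTopWeightHodge_of_thetaInv h₂₁ (cmThetaInv_of_pencilTheta hΘ) hCM h

/-- **EXACTNESS: `HC_AV ⟺ HC_CM ∧ [CM top-weight Hodge classes algebraic]`, granted [h₂₁], Verdier and (θ∀) `PencilTheta[]`.**
[cite: Andre1996Motifs, Lemme 6.3.1 (p. 31) and Remarque 2 (p. 33)] [cite: Verdier1976, Cor. 5.1] [cite: MumfordGIT, Thm. 6.14] -/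
theorem HC_AV_iff_HC_CM_and_cmTopWeightHodge_of_verdier_of_theta (h₂₁ : andre1996_cmAnchoredPencil)
    (hGT : Verdier1976_genericLocalTriviality) (hΘ : PencilTheta[]) :
    PadicSemiregularLift.HodgeAbelianVarieties ↔ (RankFourFaces.CMAbelianHodge ∧ CMTopWeightHodge[]) :=
  HC_AV_iff_HC_CM_and_cmTopWeightHodge_of_verdier_of_thetaInv h₂₁ hGT (cmThetaInv_of_pencilTheta hΘ)

end Nodes

end Summit.HodgeConjecture.HodgeConjecture.Ring2.AbelianAll

end
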